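import Literature.MathematicalPhysics.QuantumFieldTheory.Balaban1983to89.B9Eq315QLipschitz

/-!
# `Balaban1983to89.B9Eq315QFlatNorm` — T. Bałaban, *Propagators for lattice gauge theories in a background field*, Commun. Math. Phys. **99**
# (1985) 389–434 [Balaban1985BackgroundPropagators] (3.15)–(3.16) p. 393 with [Balaban1985Averaging] (125) p. 36: THE FLAT ONE-STEP VECTOR AVERAGING
# `Q(1)` OF THE pub-balaban NE9 CHAIN IS BOUNDED ON THE WEIGHTED `L²` SPACES WITH A VOLUME-FREE CONSTANT —
# `‖Q(1)f‖_{L²(c₁)} ≤ M_φ′·M_φ·√(c₁ ∕ (c₀·L^d))·‖f‖_{L²(c₀)}`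

statement-level skeleton of published theorems with citation tags; proofs where landed; nothing here is a claim about the Yang–Mills mass gap

PDF held: `paper:balaban1985-cmp99-background-propagators` (journal page = PDF page + 388), pp. 392–393, 406–407; [Balaban1985Averaging] p. 36 via the tree's
`B7Prop3Flat` docstrings; read by this seat (2026-08-22).

THE PRINT (verbatim).  [B9] p. 393, (3.15)–(3.16): the averaging operators `Q_j(U)` and *«⟨A, Q*aQA⟩ = Σ_{j=0}^{k} a Σ_{b∈Λ_j} (L^jη)^{d−2}
|(Q_j(U)A)(b)|²»*.  [B7] (125) p. 36 (tree: `B7Prop3Flat.Q0form`): *«(Q₀A)_c = Σ_{x∈B(c₋)} L^{−(d+1)} A([x, x′])»* — at the flat background the one-step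
average of a bond function at the coarse bond `c = ⟨y, y + e_κ⟩` is the mean of `A` over the `L^{d+1}` fine bonds `⟨x + ie_κ, x + (i+1)e_κ⟩`, `x ∈ B(y)`,
`0 ≤ i < L`.  p. 407: *«P₂(A) … is a semi-local operator in the sense that the value (P₂(A)A′)(b) at a bond b ∈ B_j(Λ_j) depends on A, A′ restricted to
j-blocks neighbouring the block containing the bond b.»*

WHY THIS FILE (cell context).  The NE9 owner's fixed-lattice second half of [B9] Thm 3.11 (`B9Thm311SmallFieldCoercivity.exists_coercive_principal_of_small_field`,
gen 80, §6) uses the operator norm `MQ := ‖Q(1)‖` of the chain's flat vector averaging `B9Eq315QTorus.QtorusW … (fun _ ↦ 1) …` between the weighted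
`L²` spaces (fine weight `c₀`, coarse weight `c₁`, fibre read along `φ`) as an ABSTRACT number (`LinearMap.toContinuousLinearMap … ‖·‖`) inside its
smallness threshold `ε₀` (through `K ∋ |a|(2MQ + 1)`).  For the threshold to be a function of `(d, L, η, a, c₀, c₁, M_φ, M_φ′)` alone — print's
constants «depending on d and L only» — `MQ` needs an explicit bound that does not see the volume `m`.  This file supplies it from the semi-locality
of `Q(1)`: each coarse value is a mean over `L^{d+1}` fine bonds and each fine bond is read by exactly `L` coarse bonds.

WHAT IS PROVED (sorry-free; no `Prop` placeholder; no inequality of the papers asserted).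
* §1 the shifted block charts `(y, r) ↦ (L·y + r + v) mod (L·m)` of the periodic lattice are injective (`chart_injective`), so a sum of non-negative
  terms over the chart is at most the sum over all fine sites (`sum_chart_le`).
* §2 **`norm_QtorusLin_one_apply_le`**: `‖(Q(1)A)(y, κ)‖ ≤ L^{−(d+1)}·Σ_{r}Σ_{i<L} ‖A((L·y + r + ie_κ) mod L·m, κ)‖` (flat reduction
  `B9Eq315QLipschitz.linQcov_one_eq_smul_Q0form` + `asum_seg_natCast`); **`sum_norm_sq_QtorusLin_one_le`**: `Σ_c ‖(Q(1)A)(c)‖² ≤ L^{−d}·Σ_b ‖A(b)‖²`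
  (Cauchy–Schwarz on the `L^{d+1}` terms, then §1 for each of the `L` shifts `ie_κ`).
* §3 **`norm_QtorusW_one_le`**: `‖Q(1)f‖ ≤ M_φ′·M_φ·√(c₁∕(c₀·L^d))·‖f‖` on the chain's carriers `BondL2K ℂ d (L·m) c₀ W → BondL2K ℂ d m c₁ W`, for EVERY
  admissible set of regularity letters `hα1′, hU1′, hreg′` (the value of `QtorusW` does not depend on them) — the `hQ₁` slot of
  `B9Thm311SmallFieldCoercivity.norm_principalGF_sub_flat_le` with a constant free of `m`; **`opNorm_QtorusW_one_le`**: the same number bounds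
  `‖LinearMap.toContinuousLinearMap (Q(1))‖` (the shape of §6's `MQ`).
MODEL / DECLARED READINGS.  (M1) as `B9Eq315QTorus` ∕ `B9Eq315QLipschitz`: one averaging step, periodic lattice, `L ≥ 1`, weights `c₀, c₁ > 0`, fibre letters
`‖φw‖ ≤ M_φ‖w‖`, `‖φ⁻¹X‖ ≤ M_φ′‖X‖`.  (M2) no hypothesis of the papers displayed.  (M3) the constant is explicit and volume-free; it is NOT a statement about
print's multi-level `Q_j` of (3.15) nor about (3.16)'s choice of weights (`c₁` free here).
HONEST SCOPE.  [folklore] finite-lattice bookkeeping (a mean over `L^{d+1}` bonds, an `L`-fold overlap count); one abstract constant of the owner's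
fixed-lattice Thm 3.11 second half becomes explicit and volume-free; NOT Thm 3.11, NOT (L3) W, NOT summit progress (cell pub-balaban: NE9 NOT PRINTED / NOT
PROVED; «NE9 ⇐ the named binders»; spine PROVED 0/9; HONEST DEPENDENCY: continuum YM on T⁴ ⇐ BetaPertH ∧ nine spine estimates (0/9 proved); BetaPertH ⇐
(D1) ∧ (D4) ∧ CAP+tail; G-an2-4 gates asym, D1 and NE2/3/4).  Unit `b2b-balaban-t4-ne9-formalise-leaf-03` (NE9 crux-team leaf prover, gen 58); NEW file
importing `B9Eq315QLipschitz` only; modifies nothing.  Net new unproved facts: 0.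
-/

noncomputable section

open scoped BigOperators

namespace Literature.MathematicalPhysics.QuantumFieldTheory.Balaban1983to89.B9Eq315QFlatNorm

open B7Prop1Explicit (U1 Wcx boxVec seg asum e asum_seg_natCast)
open B7Prop3Flat (Q0form)
open B4Sect5Torus (TSite)
open B9SectCLatticeCarrier (Bond)
open B9Eq319QprimeTorus (fineP)
open B9Eq311L2Pairing (WL2)
open B11Eq103H1Complex (BondL2K)
open B9Eq315QTorus (perSite perCfg cornerSite QtorusLin QtorusLin_apply QtorusW QtorusW_apply)
open B9Eq315QLipschitz (linQcov_one_eq_smul_Q0form perCfg_const_one)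

variable {d : ℕ} (L : ℕ) (m : Fin d → ℕ) [∀ i, NeZero (fineP L m i)]

/-! ## §1 The shifted block charts of the periodic lattice are injective -/

section Chart

omit [∀ i, NeZero (fineP L m i)] in
/-- The coordinates of the block point `L·y + r`. [cite: Balaban1985Averaging, (2) p.17] -/
theorem cornerSite_add_boxVec_apply (y : TSite d m) (r : Fin d → Fin L) (i : Fin d) :
    (cornerSite L y + boxVec L r) i = ((L * (y i : ℕ) + (r i : ℕ) : ℕ) : ℤ) := by
  simp only [Pi.add_apply, cornerSite, boxVec]
  push_cast
  ring

omit [∀ i, NeZero (fineP L m i)] in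
/-- The block point `L·y + r` lies in the fundamental domain: `L·y_i + r_i < L·m_i`. [cite: Balaban1985Averaging, (2) p.17] -/
theorem cornerSite_add_boxVec_lt (y : TSite d m) (r : Fin d → Fin L) (i : Fin d) : L * (y i : ℕ) + (r i : ℕ) < fineP L m i := by
  have h1 : (y i : ℕ) + 1 ≤ m i := (y i).isLt
  have h2 : (r i : ℕ) < L := (r i).isLt
  calc L * (y i : ℕ) + r i < L * (y i : ℕ) + L := by omega
    _ = L * ((y i : ℕ) + 1) := by ring
    _ ≤ L * m i := Nat.mul_le_mul_left L h1

/-- The torus reading of a site of `ℤ^d`, coordinatewise: `x_i mod (L·m_i)`. [cite: Balaban1985Averaging, (1) p.17] -/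
theorem perSite_apply_val (x : B7Prop1Explicit.Site d) (i : Fin d) :
    ((perSite (fineP L m) x i : ℕ) : ℤ) = x i % (fineP L m i : ℕ) := by
  show ((((x i) % (fineP L m i : ℤ)).toNat : ℕ) : ℤ) = x i % (fineP L m i : ℕ)
  exact Int.toNat_of_nonneg (Int.emod_nonneg _ (by exact_mod_cast NeZero.ne (fineP L m i)))

variable [NeZero L]

/-- **THE SHIFTED BLOCK CHART IS INJECTIVE**: `(y, r) ↦ (L·y + r + v) mod (L·m)` from `T^{(1)} × [0, L)^d` into the fine torus, for every shift
`v ∈ ℤ^d`. [folklore] [cite: Balaban1985Averaging, (1)–(2) p.17] -/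
theorem chart_injective (v : B7Prop1Explicit.Site d) :
    Function.Injective (fun p : TSite d m × (Fin d → Fin L) => perSite (fineP L m) (cornerSite L p.1 + boxVec L p.2 + v)) := by
  rintro ⟨y, r⟩ ⟨y', r'⟩ h
  have hL : 0 < L := Nat.pos_of_ne_zero (NeZero.ne L)
  have h0 : perSite (fineP L m) (cornerSite L y + boxVec L r + v) = perSite (fineP L m) (cornerSite L y' + boxVec L r' + v) := h
  have hi : ∀ i, L * (y i : ℕ) + (r i : ℕ) = L * (y' i : ℕ) + (r' i : ℕ) := fun i => by
    have h1 : ((perSite (fineP L m) (cornerSite L y + boxVec L r + v) i : ℕ) : ℤ) =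
        ((perSite (fineP L m) (cornerSite L y' + boxVec L r' + v) i : ℕ) : ℤ) := by rw [h0]
    rw [perSite_apply_val, perSite_apply_val, Pi.add_apply, Pi.add_apply (cornerSite L y' + boxVec L r'),
      cornerSite_add_boxVec_apply, cornerSite_add_boxVec_apply] at h1
    have ha : ((L * (y i : ℕ) + (r i : ℕ) : ℕ) : ℤ) < (fineP L m i : ℕ) := by exact_mod_cast cornerSite_add_boxVec_lt L m y r i
    have hb : ((L * (y' i : ℕ) + (r' i : ℕ) : ℕ) : ℤ) < (fineP L m i : ℕ) := by exact_mod_cast cornerSite_add_boxVec_lt L m y' r' i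
    have h2 : ((L * (y i : ℕ) + (r i : ℕ) : ℕ) : ℤ) % (fineP L m i : ℕ) = ((L * (y' i : ℕ) + (r' i : ℕ) : ℕ) : ℤ) % (fineP L m i : ℕ) :=
      Int.ModEq.add_right_cancel' (v i) h1
    rw [Int.emod_eq_of_lt (by positivity) ha, Int.emod_eq_of_lt (by positivity) hb] at h2
    exact_mod_cast h2
  have hy : y = y' := funext fun i => Fin.ext (by
    have h : (L * (y i : ℕ) + (r i : ℕ)) / L = (L * (y' i : ℕ) + (r' i : ℕ)) / L := by rw [hi i]
    rwa [Nat.mul_add_div hL, Nat.mul_add_div hL, Nat.div_eq_of_lt (r i).isLt, Nat.div_eq_of_lt (r' i).isLt, add_zero, add_zero] at h)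
  have hr : r = r' := funext fun i => Fin.ext (by
    have h : (L * (y i : ℕ) + (r i : ℕ)) % L = (L * (y' i : ℕ) + (r' i : ℕ)) % L := by rw [hi i]
    rwa [Nat.mul_add_mod, Nat.mul_add_mod, Nat.mod_eq_of_lt (r i).isLt, Nat.mod_eq_of_lt (r' i).isLt] at h)
  rw [hy, hr]

/-- A sum of non-negative terms over a shifted block chart is at most the sum over all fine sites. [folklore] [cite: Balaban1985Averaging, (1)–(2) p.17] -/
theorem sum_chart_le (v : B7Prop1Explicit.Site d) {g : TSite d (fineP L m) → ℝ} (hg : ∀ x, 0 ≤ g x) :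
    ∑ p : TSite d m × (Fin d → Fin L), g (perSite (fineP L m) (cornerSite L p.1 + boxVec L p.2 + v)) ≤ ∑ x, g x := by
  have h := Finset.sum_image (f := g) (s := (Finset.univ : Finset (TSite d m × (Fin d → Fin L))))
    (g := fun p : TSite d m × (Fin d → Fin L) => perSite (fineP L m) (cornerSite L p.1 + boxVec L p.2 + v))
    fun p _ q _ hpq => chart_injective L m v hpq
  rw [← h]
  exact Finset.sum_le_sum_of_subset_of_nonneg (Finset.subset_univ _) fun x _ _ => hg x

end Chart

/-! ## §2 `Q(1)` pointwise as a mean over `L^{d+1}` bonds; the `L²` count -/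

section Flat

variable {𝔸 : Type*} [NormedRing 𝔸] [NormOneClass 𝔸] [NormedAlgebra ℂ 𝔸] [CompleteSpace 𝔸] (hL : 1 ≤ L)
  {α' : ℝ} (hα1' : α' ≤ 1 / 64)
  (hU1' : ∀ (x : B7Prop1Explicit.Site d) (κ : Fin d), perCfg (fineP L m) (fun _ : Bond d (fineP L m) => (1 : 𝔸ˣ)) x κ ∈ U1 𝔸)
  (hreg' : ∀ (y : TSite d m) (κ : Fin d) (r : Fin d → Fin L),
    ‖((Wcx L (perCfg (fineP L m) (fun _ : Bond d (fineP L m) => (1 : 𝔸ˣ))) (cornerSite L y) κ (boxVec L r) : 𝔸ˣ) : 𝔸) - 1‖ ≤ α')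

/-- **`(Q(1)A)(y, κ)` IS THE MEAN OF `A` OVER THE `L^{d+1}` BONDS `⟨L·y + r + ie_κ, · + e_κ⟩`** (`r ∈ [0,L)^d`, `0 ≤ i < L`), read on the torus:
`(Q(1)A)(y, κ) = L^{−(d+1)}·Σ_r Σ_{i<L} A((L·y + r + ie_κ) mod L·m, κ)` ([B7] (125) at `V₀ = 1`, `B7Prop3Flat.Q0form`, via the flat reduction
`B9Eq315QLipschitz.linQcov_one_eq_smul_Q0form`). [cite: Balaban1985Averaging, (125) p.36; Balaban1985BackgroundPropagators, (3.15) p.393] -/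
theorem QtorusLin_one_apply (A : Bond d (fineP L m) → 𝔸) (c : Bond d m) :
    QtorusLin L m hL (fun _ => 1) hα1' hU1' hreg' A c =
      (((L : ℝ) ^ (d + 1))⁻¹ : ℝ) • ∑ r : Fin d → Fin L, ∑ i ∈ Finset.range L,
        A (perSite (fineP L m) (cornerSite L c.1 + boxVec L r + (i : ℤ) • e c.2), c.2) := by
  have hL0 : (L : ℂ) ≠ 0 := by exact_mod_cast (by omega : L ≠ 0)
  have hA : ∀ (x : B7Prop1Explicit.Site d) (κ : Fin d), ‖perCfg (fineP L m) A x κ‖ ≤ ‖A‖ := fun x κ => norm_le_pi_norm A _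
  rw [QtorusLin_apply, perCfg_const_one, linQcov_one_eq_smul_Q0form L (norm_nonneg A) hA hL (cornerSite L c.1) c.2,
    RCLike.real_smul_eq_coe_smul (K := ℂ), smul_smul, RCLike.ofReal_natCast, inv_mul_cancel₀ hL0, one_smul]
  unfold Q0form
  rw [Finset.smul_sum]
  refine Finset.sum_congr rfl fun r _ => ?_
  rw [asum_seg_natCast]
  rfl

/-- **POINTWISE BOUND**: `‖(Q(1)A)(y, κ)‖ ≤ L^{−(d+1)}·Σ_r Σ_{i<L} ‖A((L·y + r + ie_κ) mod L·m, κ)‖`. [cite: Balaban1985Averaging, (125) p.36] -/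
theorem norm_QtorusLin_one_apply_le (A : Bond d (fineP L m) → 𝔸) (c : Bond d m) :
    ‖QtorusLin L m hL (fun _ => 1) hα1' hU1' hreg' A c‖ ≤
      ((L : ℝ) ^ (d + 1))⁻¹ * ∑ r : Fin d → Fin L, ∑ i ∈ Finset.range L,
        ‖A (perSite (fineP L m) (cornerSite L c.1 + boxVec L r + (i : ℤ) • e c.2), c.2)‖ := by
  haveI : NeZero L := ⟨by omega⟩
  rw [QtorusLin_one_apply L m hL hα1' hU1' hreg' A c, norm_smul, Real.norm_of_nonneg (by positivity)]
  exact mul_le_mul_of_nonneg_left ((norm_sum_le _ _).trans (Finset.sum_le_sum fun r _ => norm_sum_le _ _)) (by positivity)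

/-- **THE SQUARE, BY CAUCHY–SCHWARZ over the `L^{d+1}` terms**: `‖(Q(1)A)(y, κ)‖² ≤ L^{−(d+1)}·Σ_r Σ_{i<L} ‖A((L·y + r + ie_κ) mod L·m, κ)‖²`.
[cite: Balaban1985Averaging, (125) p.36] -/
theorem norm_sq_QtorusLin_one_apply_le (A : Bond d (fineP L m) → 𝔸) (c : Bond d m) :
    ‖QtorusLin L m hL (fun _ => 1) hα1' hU1' hreg' A c‖ ^ 2 ≤
      ((L : ℝ) ^ (d + 1))⁻¹ * ∑ r : Fin d → Fin L, ∑ i ∈ Finset.range L,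
        ‖A (perSite (fineP L m) (cornerSite L c.1 + boxVec L r + (i : ℤ) • e c.2), c.2)‖ ^ 2 := by
  haveI : NeZero L := ⟨by omega⟩
  have hLd : (0 : ℝ) < (L : ℝ) ^ (d + 1) := by positivity
  set T : Finset ((Fin d → Fin L) × ℕ) := (Finset.univ : Finset (Fin d → Fin L)) ×ˢ Finset.range L with hT
  have hcard : (T.card : ℝ) = (L : ℝ) ^ (d + 1) := by
    rw [hT, Finset.card_product, Finset.card_univ, Fintype.card_fun, Fintype.card_fin, Fintype.card_fin, Finset.card_range]
    push_cast
    ring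
  set g : (Fin d → Fin L) × ℕ → ℝ := fun p => ‖A (perSite (fineP L m) (cornerSite L c.1 + boxVec L p.1 + (p.2 : ℤ) • e c.2), c.2)‖ with hg
  have h1 : ‖QtorusLin L m hL (fun _ => 1) hα1' hU1' hreg' A c‖ ≤ ((L : ℝ) ^ (d + 1))⁻¹ * ∑ p ∈ T, g p := by
    rw [hT, Finset.sum_product]
    exact norm_QtorusLin_one_apply_le L m hL hα1' hU1' hreg' A c
  have h2 : (∑ p ∈ T, g p) ^ 2 ≤ T.card * ∑ p ∈ T, g p ^ 2 := sq_sum_le_card_mul_sum_sq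
  calc ‖QtorusLin L m hL (fun _ => 1) hα1' hU1' hreg' A c‖ ^ 2 ≤ (((L : ℝ) ^ (d + 1))⁻¹ * ∑ p ∈ T, g p) ^ 2 :=
        pow_le_pow_left₀ (norm_nonneg _) h1 2
    _ = (((L : ℝ) ^ (d + 1))⁻¹) ^ 2 * (∑ p ∈ T, g p) ^ 2 := by ring
    _ ≤ (((L : ℝ) ^ (d + 1))⁻¹) ^ 2 * (T.card * ∑ p ∈ T, g p ^ 2) := mul_le_mul_of_nonneg_left h2 (by positivity)
    _ = ((L : ℝ) ^ (d + 1))⁻¹ * ∑ p ∈ T, g p ^ 2 := by rw [hcard]; field_simp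
    _ = ((L : ℝ) ^ (d + 1))⁻¹ * ∑ r : Fin d → Fin L, ∑ i ∈ Finset.range L,
          ‖A (perSite (fineP L m) (cornerSite L c.1 + boxVec L r + (i : ℤ) • e c.2), c.2)‖ ^ 2 := by rw [hT, Finset.sum_product]

/-- **THE `L²` COUNT: `Σ_c ‖(Q(1)A)(c)‖² ≤ L^{−d}·Σ_b ‖A(b)‖²`** — each fine bond `⟨x, x + e_κ⟩` is read by exactly the `L` coarse bonds `⟨y, y + e_κ⟩` with
`x − ie_κ ∈ B(y)`, `0 ≤ i < L` (§1 for each shift `ie_κ`); volume-free. [cite: Balaban1985Averaging, (125) p.36; Balaban1985BackgroundPropagators, (3.15)–(3.16) p.393, p.407] -/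
theorem sum_norm_sq_QtorusLin_one_le (A : Bond d (fineP L m) → 𝔸) :
    ∑ c, ‖QtorusLin L m hL (fun _ => 1) hα1' hU1' hreg' A c‖ ^ 2 ≤ ((L : ℝ) ^ d)⁻¹ * ∑ b, ‖A b‖ ^ 2 := by
  haveI : NeZero L := ⟨by omega⟩
  have hL0 : (L : ℝ) ≠ 0 := by exact_mod_cast (by omega : L ≠ 0)
  -- the summand, as a function of the direction `κ`, the shift `i` and the chart point `(y, r)`
  set t : Fin d → ℕ → TSite d m → (Fin d → Fin L) → ℝ :=
    fun κ i y r => ‖A (perSite (fineP L m) (cornerSite L y + boxVec L r + (i : ℤ) • e κ), κ)‖ ^ 2 with ht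
  -- per direction and shift, the chart inequality of §1
  have hshift : ∀ (κ : Fin d) (i : ℕ), ∑ p : TSite d m × (Fin d → Fin L), t κ i p.1 p.2 ≤ ∑ x : TSite d (fineP L m), ‖A (x, κ)‖ ^ 2 :=
    fun κ i => sum_chart_le L m ((i : ℤ) • e κ) (g := fun x => ‖A (x, κ)‖ ^ 2) fun x => sq_nonneg _
  -- re-indexing: `Σ_{(y,κ)} Σ_r Σ_i = Σ_κ Σ_i Σ_{(y,r)}`
  have hre : ∑ c : Bond d m, ∑ r : Fin d → Fin L, ∑ i ∈ Finset.range L, t c.2 i c.1 r =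
      ∑ κ : Fin d, ∑ i ∈ Finset.range L, ∑ p : TSite d m × (Fin d → Fin L), t κ i p.1 p.2 := by
    rw [Fintype.sum_prod_type, Finset.sum_comm]
    refine Finset.sum_congr rfl fun κ _ => ?_
    calc ∑ y : TSite d m, ∑ r : Fin d → Fin L, ∑ i ∈ Finset.range L, t κ i y r
        = ∑ y : TSite d m, ∑ i ∈ Finset.range L, ∑ r : Fin d → Fin L, t κ i y r := Finset.sum_congr rfl fun y _ => Finset.sum_comm
      _ = ∑ i ∈ Finset.range L, ∑ y : TSite d m, ∑ r : Fin d → Fin L, t κ i y r := Finset.sum_comm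
      _ = ∑ i ∈ Finset.range L, ∑ p : TSite d m × (Fin d → Fin L), t κ i p.1 p.2 :=
          Finset.sum_congr rfl fun i _ => (Fintype.sum_prod_type' _).symm
  have hb : ∑ b : Bond d (fineP L m), ‖A b‖ ^ 2 = ∑ κ : Fin d, ∑ x : TSite d (fineP L m), ‖A (x, κ)‖ ^ 2 := by
    rw [Fintype.sum_prod_type, Finset.sum_comm]
  calc ∑ c, ‖QtorusLin L m hL (fun _ => 1) hα1' hU1' hreg' A c‖ ^ 2
      ≤ ∑ c : Bond d m, ((L : ℝ) ^ (d + 1))⁻¹ * ∑ r : Fin d → Fin L, ∑ i ∈ Finset.range L, t c.2 i c.1 r :=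
        Finset.sum_le_sum fun c _ => norm_sq_QtorusLin_one_apply_le L m hL hα1' hU1' hreg' A c
    _ = ((L : ℝ) ^ (d + 1))⁻¹ * ∑ κ : Fin d, ∑ i ∈ Finset.range L, ∑ p : TSite d m × (Fin d → Fin L), t κ i p.1 p.2 := by
        rw [← Finset.mul_sum, hre]
    _ ≤ ((L : ℝ) ^ (d + 1))⁻¹ * ∑ κ : Fin d, ∑ _i ∈ Finset.range L, ∑ x : TSite d (fineP L m), ‖A (x, κ)‖ ^ 2 :=
        mul_le_mul_of_nonneg_left (Finset.sum_le_sum fun κ _ => Finset.sum_le_sum fun i _ => hshift κ i) (by positivity)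
    _ = ((L : ℝ) ^ d)⁻¹ * ∑ b, ‖A b‖ ^ 2 := by
        rw [hb]
        simp only [Finset.sum_const, Finset.card_range, nsmul_eq_mul]
        rw [← Finset.mul_sum, pow_succ]
        field_simp

end Flat

/-! ## §3 On the chain's weighted `L²` carriers: `‖Q(1)f‖ ≤ M_φ′·M_φ·√(c₁∕(c₀·L^d))·‖f‖` -/

section Carrier

variable {𝔸 : Type*} [NormedRing 𝔸] [NormOneClass 𝔸] [NormedAlgebra ℂ 𝔸] [CompleteSpace 𝔸] (hL : 1 ≤ L)
  {α' : ℝ} (hα1' : α' ≤ 1 / 64)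
  (hU1' : ∀ (x : B7Prop1Explicit.Site d) (κ : Fin d), perCfg (fineP L m) (fun _ : Bond d (fineP L m) => (1 : 𝔸ˣ)) x κ ∈ U1 𝔸)
  (hreg' : ∀ (y : TSite d m) (κ : Fin d) (r : Fin d → Fin L),
    ‖((Wcx L (perCfg (fineP L m) (fun _ : Bond d (fineP L m) => (1 : 𝔸ˣ))) (cornerSite L y) κ (boxVec L r) : 𝔸ˣ) : 𝔸) - 1‖ ≤ α')
  {W : Type*} [NormedAddCommGroup W] [InnerProductSpace ℂ W] (φ : W ≃ₗ[ℂ] 𝔸) {c₀ c₁ : ℝ} [Fact (0 < c₀)] [Fact (0 < c₁)]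
  {Mφ Mφ' : ℝ} (hMφ : 0 ≤ Mφ) (hφ : ∀ w, ‖φ w‖ ≤ Mφ * ‖w‖) (hMφ' : 0 ≤ Mφ') (hφ' : ∀ X, ‖φ.symm X‖ ≤ Mφ' * ‖X‖)

include hMφ hφ hMφ' hφ' in
/-- **THE FLAT VECTOR AVERAGING OF THE NE9 CHAIN IS BOUNDED WITH A VOLUME-FREE CONSTANT**: on the weighted `L²` spaces of `W`-valued bond functions
(fine weight `c₀`, coarse weight `c₁`, fibre along `φ`), `‖Q(1)f‖ ≤ M_φ′·M_φ·√(c₁∕(c₀·L^d))·‖f‖` — §2's count read through `φ`, `φ⁻¹` and the two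
weights.  The `MQ`∕`hQ₁` slot of `B9Thm311SmallFieldCoercivity.norm_principalGF_sub_flat_le` with a constant independent of the volume `m`.
[cite: Balaban1985BackgroundPropagators, (3.15)–(3.16) p.393, (3.82) p.407; Balaban1985Averaging, (125) p.36] -/
theorem norm_QtorusW_one_le (f : BondL2K ℂ d (fineP L m) c₀ W) :
    ‖QtorusW L m hL φ (fun _ => 1) hα1' hU1' hreg' (c₁ := c₁) f‖ ≤ Mφ' * Mφ * Real.sqrt (c₁ / (c₀ * (L : ℝ) ^ d)) * ‖f‖ := by
  haveI : NeZero L := ⟨by omega⟩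
  have hc₀ : 0 < c₀ := Fact.out
  have hc₁ : 0 < c₁ := Fact.out
  have hLd : (0 : ℝ) < (L : ℝ) ^ d := by positivity
  set g : Bond d (fineP L m) → 𝔸 := fun b => φ (WL2.equiv ℂ (fun _ : Bond d (fineP L m) => c₀) W f b) with hg
  -- the fine side: `Σ_b ‖g b‖² ≤ M_φ²·c₀⁻¹·‖f‖²`
  have hn : ‖f‖ ^ 2 = ∑ b, c₀ * ‖WL2.equiv ℂ (fun _ : Bond d (fineP L m) => c₀) W f b‖ ^ 2 :=
    WL2.norm_sq (𝕜 := ℂ) (w := fun _ : Bond d (fineP L m) => c₀) (V := W) f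
  have hfine : ∑ b, ‖g b‖ ^ 2 ≤ Mφ ^ 2 * (c₀⁻¹ * ‖f‖ ^ 2) := by
    rw [hn, Finset.mul_sum, Finset.mul_sum]
    refine Finset.sum_le_sum fun b _ => ?_
    have h1 : ‖g b‖ ^ 2 ≤ (Mφ * ‖WL2.equiv ℂ (fun _ : Bond d (fineP L m) => c₀) W f b‖) ^ 2 :=
      pow_le_pow_left₀ (norm_nonneg _) (hφ _) 2
    refine h1.trans (le_of_eq ?_)
    field_simp
  -- the coarse side, pointwise through `φ⁻¹`
  have hpt : ∀ c : Bond d m, ‖WL2.equiv ℂ (fun _ : Bond d m => c₁) W (QtorusW L m hL φ (fun _ => 1) hα1' hU1' hreg' (c₁ := c₁) f) c‖ ^ 2 ≤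
      Mφ' ^ 2 * ‖QtorusLin L m hL (fun _ => 1) hα1' hU1' hreg' g c‖ ^ 2 := fun c => by
    rw [QtorusW_apply, ← mul_pow]
    exact pow_le_pow_left₀ (norm_nonneg _) (hφ' _) 2
  have hsq : ‖QtorusW L m hL φ (fun _ => 1) hα1' hU1' hreg' (c₁ := c₁) f‖ ^ 2 ≤
      (Mφ' * Mφ * Real.sqrt (c₁ / (c₀ * (L : ℝ) ^ d)) * ‖f‖) ^ 2 :=
    calc ‖QtorusW L m hL φ (fun _ => 1) hα1' hU1' hreg' (c₁ := c₁) f‖ ^ 2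
        = ∑ c, c₁ * ‖WL2.equiv ℂ (fun _ : Bond d m => c₁) W (QtorusW L m hL φ (fun _ => 1) hα1' hU1' hreg' (c₁ := c₁) f) c‖ ^ 2 :=
          WL2.norm_sq (𝕜 := ℂ) (w := fun _ : Bond d m => c₁) (V := W) _
      _ ≤ ∑ c, c₁ * (Mφ' ^ 2 * ‖QtorusLin L m hL (fun _ => 1) hα1' hU1' hreg' g c‖ ^ 2) :=
          Finset.sum_le_sum fun c _ => mul_le_mul_of_nonneg_left (hpt c) hc₁.le
      _ = c₁ * Mφ' ^ 2 * ∑ c, ‖QtorusLin L m hL (fun _ => 1) hα1' hU1' hreg' g c‖ ^ 2 := by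
          rw [Finset.mul_sum]; exact Finset.sum_congr rfl fun c _ => by ring
      _ ≤ c₁ * Mφ' ^ 2 * (((L : ℝ) ^ d)⁻¹ * ∑ b, ‖g b‖ ^ 2) :=
          mul_le_mul_of_nonneg_left (sum_norm_sq_QtorusLin_one_le L m hL hα1' hU1' hreg' g) (by positivity)
      _ ≤ c₁ * Mφ' ^ 2 * (((L : ℝ) ^ d)⁻¹ * (Mφ ^ 2 * (c₀⁻¹ * ‖f‖ ^ 2))) :=
          mul_le_mul_of_nonneg_left (mul_le_mul_of_nonneg_left hfine (by positivity)) (by positivity)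
      _ = (Mφ' * Mφ * Real.sqrt (c₁ / (c₀ * (L : ℝ) ^ d)) * ‖f‖) ^ 2 := by
          rw [mul_pow, mul_pow, mul_pow, Real.sq_sqrt (by positivity)]
          field_simp
  exact (pow_le_pow_iff_left₀ (norm_nonneg _) (by positivity) two_ne_zero).1 hsq

include hMφ hφ hMφ' hφ' in
/-- **… AS AN OPERATOR-NORM BOUND** (the shape of `B9Thm311SmallFieldCoercivity` §6's `MQ := ‖LinearMap.toContinuousLinearMap (Q(1))‖`):
`‖Q(1)‖_{L²(c₀) → L²(c₁)} ≤ M_φ′·M_φ·√(c₁∕(c₀·L^d))`, volume-free. [cite: Balaban1985BackgroundPropagators, (3.15)–(3.16) p.393, (3.82) p.407] -/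
theorem opNorm_QtorusW_one_le [FiniteDimensional ℂ W] :
    ‖LinearMap.toContinuousLinearMap (QtorusW L m hL φ (fun _ => 1) hα1' hU1' hreg' (c₀ := c₀) (c₁ := c₁))‖ ≤
      Mφ' * Mφ * Real.sqrt (c₁ / (c₀ * (L : ℝ) ^ d)) :=
  ContinuousLinearMap.opNorm_le_bound _ (by positivity) fun f => norm_QtorusW_one_le L m hL hα1' hU1' hreg' φ hMφ hφ hMφ' hφ' f

end Carrier

end Literature.MathematicalPhysics.QuantumFieldTheory.Balaban1983to89.B9Eq315QFlatNorm

end
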